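import Summits.BirchSwinnertonDyer.BirchSwinnertonDyer.Theorems.ManinLocalTwoThreePlaneIndexTransport
import Summits.BirchSwinnertonDyer.Rank1Residual.O5.CharTwistThreeIsometry
import Literature.NumberTheory.EllipticCurves.NewformsRealCoefficients
import Literature.NumberTheory.EllipticCurves.NewformsCoeffFieldHolds
import HarnessLib

/-!
# P-desc-2 `MemConwayNortonOfSameLevelTwist` IS A THEOREM, and the non-rational dichotomy for `M^G ∩ (ℤf + ℤζ₃f)`

Summit `BirchSwinnertonDyer`, sub-problem `BirchSwinnertonDyer`, route `ManinLocalTwoThree`; width seat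
`bsd-line-manin23-p2` (gen 9), `--supports` the crux C3 `ManinPrimeToThreeAtNine` (stmt-BirchSwinnertonDyer-22968).
Cell `bsd-f2-manin`, descent lens: desc g10 MEMO-desc §27.1 «P-desc-2 → prover-2» (answer to this seat's g8 gap note on
E-desc-52 `EisensteinDepthTwistLipschitz`, INBOX l.793).  Second of three files (after `…PlaneIndexTransport`); the
by-name theorem E-desc-52 is assembled in `…EisensteinDepthTwistLipschitz`.

PROVED here (sorry-free), for `9 ∣ N`, THE primitive quadratic character `χ` mod `3`, a newform `f` and `g = f ⊗ χ`:

* `cuspCoeff_trichotomy_mod_three` — at each `n`: `3 ∣ n ∧ aₙ(f) = 0`, or `χ(n) = 1 ∧ ζ₃ⁿ = ζ₃`, or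
  `χ(n) = −1 ∧ ζ₃ⁿ = ζ₃²` (`f` is `3`-depleted);
* `thirdTranslate_one_add_charTwist`, `thirdTranslate_one_sub_charTwist` — **`t_{1/3}(f ± g) = ζ₃^{1,2}·(f ± g)`**:
  `u = (f+g)/2`, `v = (f−g)/2` are EIGENVECTORS of the translation `t_{1/3}`;
* `half_smul_add_sub_charTwist_mem_integralCuspForms0` — `u, v ∈ S₂(Γ₀(N);ℤ)` when `f` has integer coefficients;
* **`memConwayNortonLatticeAtThree_of_sameLevelTwist`** = P-desc-2 (desc g10 Sketch-desc-g10 :151 VERBATIM binders):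
  `f` rational newform, `g` newform of level `N` ⇒ `f, g ∈ M^G(N)` — the lattice `ℤu + ℤv + ℤζ₃u + ℤζ₃v ≤ S ⊗ ℤ[ζ₃]`
  is `ζ₃`-, `w_Q`- (`w_Q u ∈ {±u, ±v}`) and `t_{1/3}`-stable, so below `M^G` by maximality;
* `eq_zero_of_add_mul_zeta3_eq_zero` (`{1, ζ₃}` is `ℝ`-free), `exists_int_cuspCoeff_of_rat` (rational algebraic
  integer coefficient is an integer), **`int_cuspCoeff_of_mem_span_pair_of_mem_eisensteinSpan`** (a nonzero element of
  `ℤh + ℤζ₃h` inside `S ⊗ ℤ[ζ₃]` forces the newform `h` to be rational — reality `IsNewform0.conj_cuspCoeff` +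
  integrality `IsNewform0.isIntegral_coeff_holds` of newform coefficients),
  `conwayNortonLatticeAtThree_inf_span_pair_eq_bot` (so `M^G ∩ (ℤh + ℤζ₃h) = 0` for non-rational `h`),
  `int_cuspCoeff_of_int_cuspCoeff_charTwist` (`g` rational ⇒ `f` rational).

Elementary `q`-expansion bookkeeping (Atkin–Lehner 1970 §4; Shimura 1971 Thm. 3.48 / Prop. 3.64 via the tree).  BSD is
not proved by this; Manin's conjecture is not proved by this.
-/

set_option autoImplicit false
set_option linter.dupNamespace false

noncomputable section

open scoped MatrixGroups ModularForm ComplexConjugate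
open CongruenceSubgroup
open Literature.NumberTheory.EllipticCurves Literature.NumberTheory.EllipticCurves.ModularForms
open Summit.BirchSwinnertonDyer.Rank1Residual.ManinAdditive
open Summit.BirchSwinnertonDyer.Rank1Residual.ManinAdditive.RamanujanCut
open Summit.BirchSwinnertonDyer.Rank1Residual.ManinAdditive.ConwayNortonThree
open Summit.BirchSwinnertonDyer.Rank1Residual.O5

namespace Summit.BirchSwinnertonDyer.BirchSwinnertonDyer.Theorems.ManinLocalTwoThree

variable {N : ℕ} [NeZero N]

/-! ### `q`-expansion bookkeeping for the pair `f`, `g = f ⊗ χ₋₃` -/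

omit [NeZero N] in
/-- `aₙ(c • f) = c · aₙ(f)` on `Γ₀(N)`. -/
theorem cuspCoeff_smul_gamma0 {k : ℤ} (c : ℂ) (f : CuspForm (Gamma0 N) k) (n : ℕ) :
    cuspCoeff (c • f) n = c * cuspCoeff f n := by
  rw [← cuspCoeffₗ_apply (one_mem_strictPeriods_coe_gamma0 N) n, map_smul, smul_eq_mul, cuspCoeffₗ_apply]

omit [NeZero N] in
/-- `aₙ(f + g) = aₙ(f) + aₙ(g)` on `Γ₀(N)`. -/
theorem cuspCoeff_add_gamma0 {k : ℤ} (f g : CuspForm (Gamma0 N) k) (n : ℕ) :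
    cuspCoeff (f + g) n = cuspCoeff f n + cuspCoeff g n :=
  cuspCoeff_add_form (one_mem_strictPeriods_coe_gamma0 N) f g n

omit [NeZero N] in
/-- `aₙ(f − g) = aₙ(f) − aₙ(g)` on `Γ₀(N)`. -/
theorem cuspCoeff_sub_gamma0 {k : ℤ} (f g : CuspForm (Gamma0 N) k) (n : ℕ) :
    cuspCoeff (f - g) n = cuspCoeff f n - cuspCoeff g n := by
  rw [← cuspCoeffₗ_apply (one_mem_strictPeriods_coe_gamma0 N) n, map_sub, cuspCoeffₗ_apply, cuspCoeffₗ_apply]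

/-- **Residues mod `3`**: for a `3`-depleted pair — a newform `f` at `9 ∣ N` and THE primitive quadratic `χ` mod `3` —
at every `n` one of: `3 ∣ n` and `aₙ(f) = 0`; `n ≡ 1` with `χ(n) = 1`, `ζ₃ⁿ = ζ₃`; `n ≡ 2` with `χ(n) = −1`,
`ζ₃ⁿ = ζ₃²`. -/
theorem cuspCoeff_trichotomy_mod_three (h9 : 3 ^ 2 ∣ N) {χ : DirichletCharacter ℂ 3} (hχ : χ.IsQuadratic)
    (hprim : χ.IsPrimitive) {f : CuspForm (Gamma0 N) 2} (hf : IsNewform0 f) (n : ℕ) :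
    cuspCoeff f n = 0 ∨ (χ (n : ZMod 3) = 1 ∧ zeta3 ^ n = zeta3) ∨ (χ (n : ZMod 3) = -1 ∧ zeta3 ^ n = zeta3 ^ 2) := by
  have h9' : 9 ∣ N := by simpa using h9
  have h3 : zeta3 ^ 3 = 1 := isPrimitiveRoot_zeta3.pow_eq_one
  obtain ⟨q, r, hr, rfl⟩ : ∃ q r : ℕ, r < 3 ∧ n = 3 * q + r :=
    ⟨n / 3, n % 3, Nat.mod_lt _ (by norm_num), (Nat.div_add_mod n 3).symm⟩
  have hpow : zeta3 ^ (3 * q + r) = zeta3 ^ r := by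
    rw [pow_add, pow_mul, h3, one_pow, one_mul]
  have hcast : ((3 * q + r : ℕ) : ZMod 3) = (r : ZMod 3) := by
    push_cast
    rw [show (3 : ZMod 3) = 0 from rfl, zero_mul, zero_add]
  rw [hpow, hcast]
  interval_cases r
  · exact Or.inl (cuspCoeff_eq_zero_of_three_dvd_of_isNewform0 hf h9' ⟨q, by ring⟩)
  · exact Or.inr (Or.inl ⟨by rw [Nat.cast_one, map_one], pow_one _⟩)
  · exact Or.inr (Or.inr ⟨by rw [show ((2 : ℕ) : ZMod 3) = 2 from rfl]; exact chi_three_apply_two hχ hprim, rfl⟩)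

/-- **`t_{1/3}(f + f ⊗ χ) = ζ₃ · (f + f ⊗ χ)`**: the coefficients of `f + f ⊗ χ` live on `n ≡ 1 (mod 3)`. -/
theorem thirdTranslate_one_add_charTwist (h9 : 3 ^ 2 ∣ N) {χ : DirichletCharacter ℂ 3} (hχ : χ.IsQuadratic)
    (hprim : χ.IsPrimitive) {f : CuspForm (Gamma0 N) 2} (hf : IsNewform0 f) :
    thirdTranslate N 2 1 (f + charTwist N dvd_rfl h9 hχ f) = zeta3 • (f + charTwist N dvd_rfl h9 hχ f) := by
  have h9' : 9 ∣ N := by simpa using h9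
  refine eq_of_forall_cuspCoeff_eq_gamma0 fun n => ?_
  rw [cuspCoeff_thirdTranslate_two h9', pow_one, cuspCoeff_smul_gamma0, cuspCoeff_add_gamma0,
    cuspCoeff_charTwist (L := N) (hN := dvd_rfl) (hm := h9) (hχ := hχ) (hprim := hprim) (f := f) (n := n)]
  rcases cuspCoeff_trichotomy_mod_three h9 hχ hprim hf n with h0 | ⟨h1, hz⟩ | ⟨h2, hz⟩
  · rw [h0]; ring
  · rw [h1, hz]
  · rw [h2, hz]; ring

/-- **`t_{1/3}(f − f ⊗ χ) = ζ₃² · (f − f ⊗ χ)`**: the coefficients of `f − f ⊗ χ` live on `n ≡ 2 (mod 3)`. -/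
theorem thirdTranslate_one_sub_charTwist (h9 : 3 ^ 2 ∣ N) {χ : DirichletCharacter ℂ 3} (hχ : χ.IsQuadratic)
    (hprim : χ.IsPrimitive) {f : CuspForm (Gamma0 N) 2} (hf : IsNewform0 f) :
    thirdTranslate N 2 1 (f - charTwist N dvd_rfl h9 hχ f) = zeta3 ^ 2 • (f - charTwist N dvd_rfl h9 hχ f) := by
  have h9' : 9 ∣ N := by simpa using h9
  refine eq_of_forall_cuspCoeff_eq_gamma0 fun n => ?_
  rw [cuspCoeff_thirdTranslate_two h9', pow_one, cuspCoeff_smul_gamma0, cuspCoeff_sub_gamma0,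
    cuspCoeff_charTwist (L := N) (hN := dvd_rfl) (hm := h9) (hχ := hχ) (hprim := hprim) (f := f) (n := n)]
  rcases cuspCoeff_trichotomy_mod_three h9 hχ hprim hf n with h0 | ⟨h1, hz⟩ | ⟨h2, hz⟩
  · rw [h0]; ring
  · rw [h1, hz]; ring
  · rw [h2, hz]

/-- **`(f ± f ⊗ χ)/2 ∈ S₂(Γ₀(N); ℤ)`** for a newform `f` with integer coefficients (`f ≡ f ⊗ χ` coefficientwise mod `2`:
`aₙ(f ⊗ χ) = ±aₙ(f)` off `3 ∣ n`, where `aₙ(f) = 0`). -/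
theorem half_smul_add_sub_charTwist_mem_integralCuspForms0 (h9 : 3 ^ 2 ∣ N) {χ : DirichletCharacter ℂ 3}
    (hχ : χ.IsQuadratic) (hprim : χ.IsPrimitive) {f : CuspForm (Gamma0 N) 2} (hf : IsNewform0 f)
    (hint : ∀ n : ℕ, ∃ a : ℤ, cuspCoeff f n = a) :
    (2 : ℂ)⁻¹ • (f + charTwist N dvd_rfl h9 hχ f) ∈ integralCuspForms0 N 2 ∧
      (2 : ℂ)⁻¹ • (f - charTwist N dvd_rfl h9 hχ f) ∈ integralCuspForms0 N 2 := by
  constructor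
  · intro n
    rw [cuspCoeff_smul_gamma0, cuspCoeff_add_gamma0,
      cuspCoeff_charTwist (L := N) (hN := dvd_rfl) (hm := h9) (hχ := hχ) (hprim := hprim) (f := f) (n := n)]
    obtain ⟨a, ha⟩ := hint n
    rcases cuspCoeff_trichotomy_mod_three h9 hχ hprim hf n with h0 | ⟨h1, -⟩ | ⟨h2, -⟩
    · exact ⟨0, by rw [h0]; simp⟩
    · exact ⟨a, by rw [h1, ha]; ring⟩
    · exact ⟨0, by rw [h2]; simp⟩
  · intro n
    rw [cuspCoeff_smul_gamma0, cuspCoeff_sub_gamma0,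
      cuspCoeff_charTwist (L := N) (hN := dvd_rfl) (hm := h9) (hχ := hχ) (hprim := hprim) (f := f) (n := n)]
    obtain ⟨a, ha⟩ := hint n
    rcases cuspCoeff_trichotomy_mod_three h9 hχ hprim hf n with h0 | ⟨h1, -⟩ | ⟨h2, -⟩
    · exact ⟨0, by rw [h0]; simp⟩
    · exact ⟨0, by rw [h1]; simp⟩
    · exact ⟨a, by rw [h2, ha]; ring⟩

/-! ### P-desc-2: `f, f ⊗ χ₋₃ ∈ M^G(N)` for a rational same-level newform pair -/

/-- **P-desc-2 `MemConwayNortonOfSameLevelTwist` IS A THEOREM** (desc g10, MEMO-desc §27.1; answer to this seat's g8 gap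
note on E-desc-52): for `9 ∣ N`, a newform `f` with INTEGER coefficients whose `χ₋₃`-twist `g = f ⊗ χ₋₃` is again a
newform of level `N`, both `f` and `g` lie in the Conway–Norton lattice `M^G(N)`.  Proof: with `u = (f+g)/2`,
`v = (f−g)/2 ∈ S₂(Γ₀(N);ℤ)`, the lattice `M₀ = ℤu + ℤv + ℤζ₃u + ℤζ₃v ≤ S ⊗ ℤ[ζ₃]` is `ζ₃`-stable, `w_{Q_p}`-stable
(`w_Q f = ±f`, `w_Q g = ±g`, so `w_Q u ∈ {±u, ±v}`) and `t_{1/3}`-stable (`u`, `v` are EIGENVECTORS of `t_{1/3}` with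
eigenvalues `ζ₃`, `ζ₃²`), hence `M₀ ≤ M^G` by maximality; and `f = u + v`, `g = u − v`.  (The second newform
hypothesis is used only through `w_Q g = ±g`.) -/
theorem memConwayNortonLatticeAtThree_of_sameLevelTwist (h9 : 3 ^ 2 ∣ N) {χ : DirichletCharacter ℂ 3}
    (hχ : χ.IsQuadratic) (hprim : χ.IsPrimitive) {f : CuspForm (Gamma0 N) 2} (hf : IsNewform0 f)
    (hg : IsNewform0 (charTwist N dvd_rfl h9 hχ f)) (hint : ∀ n : ℕ, ∃ a : ℤ, cuspCoeff f n = a) :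
    f ∈ conwayNortonLatticeAtThree N ∧ charTwist N dvd_rfl h9 hχ f ∈ conwayNortonLatticeAtThree N := by
  have h3 : zeta3 ^ 3 = 1 := isPrimitiveRoot_zeta3.pow_eq_one
  have h3' : zeta3 * zeta3 ^ 2 = 1 := by rw [← pow_succ']; exact h3
  have hζ2 : ∀ x : CuspForm (Gamma0 N) 2, zeta3 ^ 2 • x = -x - zeta3 • x := by
    intro x
    rw [zeta3_sq, sub_smul, neg_smul, one_smul]
  -- the facts about `u = (f+g)/2`, `v = (f−g)/2`, stated for the explicit expressions, then generalised
  obtain ⟨g, hgdef⟩ : ∃ g, charTwist N dvd_rfl h9 hχ f = g := ⟨_, rfl⟩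
  rw [hgdef] at hg ⊢
  obtain ⟨huS, hvS⟩ := half_smul_add_sub_charTwist_mem_integralCuspForms0 h9 hχ hprim hf hint
  have htu : thirdTranslate N 2 1 ((2 : ℂ)⁻¹ • (f + g)) = zeta3 • ((2 : ℂ)⁻¹ • (f + g)) := by
    rw [map_smul, ← hgdef, thirdTranslate_one_add_charTwist h9 hχ hprim hf, smul_comm]
  have htv : thirdTranslate N 2 1 ((2 : ℂ)⁻¹ • (f - g)) = zeta3 ^ 2 • ((2 : ℂ)⁻¹ • (f - g)) := by
    rw [map_smul, ← hgdef, thirdTranslate_one_sub_charTwist h9 hχ hprim hf, smul_comm]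
  rw [hgdef] at huS hvS
  have hw : ∀ p : ℕ, p.Prime → p ∣ N →
      (atkinLehnerInvolutionAt N 2 p ((2 : ℂ)⁻¹ • (f + g)) = (2 : ℂ)⁻¹ • (f + g) ∨
        atkinLehnerInvolutionAt N 2 p ((2 : ℂ)⁻¹ • (f + g)) = -((2 : ℂ)⁻¹ • (f + g)) ∨
        atkinLehnerInvolutionAt N 2 p ((2 : ℂ)⁻¹ • (f + g)) = (2 : ℂ)⁻¹ • (f - g) ∨
        atkinLehnerInvolutionAt N 2 p ((2 : ℂ)⁻¹ • (f + g)) = -((2 : ℂ)⁻¹ • (f - g))) ∧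
      (atkinLehnerInvolutionAt N 2 p ((2 : ℂ)⁻¹ • (f - g)) = (2 : ℂ)⁻¹ • (f - g) ∨
        atkinLehnerInvolutionAt N 2 p ((2 : ℂ)⁻¹ • (f - g)) = -((2 : ℂ)⁻¹ • (f - g)) ∨
        atkinLehnerInvolutionAt N 2 p ((2 : ℂ)⁻¹ • (f - g)) = (2 : ℂ)⁻¹ • (f + g) ∨
        atkinLehnerInvolutionAt N 2 p ((2 : ℂ)⁻¹ • (f - g)) = -((2 : ℂ)⁻¹ • (f + g))) := by
    intro p hp hpN
    obtain ⟨ε, hε, hεf⟩ := IsNewform0.exists_atkinLehnerInvolutionAt_eq_smul_holds hf hp hpN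
    obtain ⟨ε', hε', hεg⟩ := IsNewform0.exists_atkinLehnerInvolutionAt_eq_smul_holds hg hp hpN
    rw [map_smul, map_add, map_smul, map_sub, hεf, hεg]
    rcases hε with rfl | rfl <;> rcases hε' with rfl | rfl
    · exact ⟨Or.inl (by module), Or.inl (by module)⟩
    · exact ⟨Or.inr (Or.inr (Or.inl (by module))), Or.inr (Or.inr (Or.inl (by module)))⟩
    · exact ⟨Or.inr (Or.inr (Or.inr (by module))), Or.inr (Or.inr (Or.inr (by module)))⟩
    · exact ⟨Or.inr (Or.inl (by module)), Or.inr (Or.inl (by module))⟩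
  have hfuv : f = (2 : ℂ)⁻¹ • (f + g) + (2 : ℂ)⁻¹ • (f - g) := by module
  have hguv : g = (2 : ℂ)⁻¹ • (f + g) - (2 : ℂ)⁻¹ • (f - g) := by module
  generalize (2 : ℂ)⁻¹ • (f + g) = u at huS htu hw hfuv hguv
  generalize (2 : ℂ)⁻¹ • (f - g) = v at hvS htv hw hfuv hguv
  -- the lattice `M₀ = ℤu + ℤv + ℤζ₃u + ℤζ₃v`
  obtain ⟨M₀, hM₀⟩ : ∃ M₀ : Submodule ℤ (CuspForm (Gamma0 N) 2), M₀ = Submodule.span ℤ {u, v, zeta3 • u, zeta3 • v} :=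
    ⟨_, rfl⟩
  have hu : u ∈ M₀ := hM₀ ▸ Submodule.subset_span (by simp)
  have hv : v ∈ M₀ := hM₀ ▸ Submodule.subset_span (by simp)
  have hζu : zeta3 • u ∈ M₀ := hM₀ ▸ Submodule.subset_span (by simp)
  have hζv : zeta3 • v ∈ M₀ := hM₀ ▸ Submodule.subset_span (by simp)
  have hζζu : zeta3 • zeta3 • u ∈ M₀ := by
    rw [smul_smul, ← sq, hζ2]; exact M₀.sub_mem (M₀.neg_mem hu) hζu
  have hζζv : zeta3 • zeta3 • v ∈ M₀ := by
    rw [smul_smul, ← sq, hζ2]; exact M₀.sub_mem (M₀.neg_mem hv) hζv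
  -- `ζ₃`-stability
  have hζ : ∀ x ∈ M₀, zeta3 • x ∈ M₀ := by
    have h : M₀.map ((zeta3 • LinearMap.id : CuspForm (Gamma0 N) 2 →ₗ[ℂ] CuspForm (Gamma0 N) 2).restrictScalars ℤ)
        ≤ M₀ := by
      rw [hM₀, Submodule.map_span_le, ← hM₀]
      intro x hx
      simp only [Set.mem_insert_iff, Set.mem_singleton_iff] at hx
      change zeta3 • x ∈ _
      rcases hx with rfl | rfl | rfl | rfl
      exacts [hζu, hζv, hζζu, hζζv]
    exact fun x hx => h ⟨x, hx, rfl⟩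
  have hpm : ∀ {x y y' : CuspForm (Gamma0 N) 2}, y ∈ M₀ → y' ∈ M₀ → (x = y ∨ x = -y ∨ x = y' ∨ x = -y') → x ∈ M₀ := by
    rintro x y y' hy hy' (rfl | rfl | rfl | rfl)
    exacts [hy, M₀.neg_mem hy, hy', M₀.neg_mem hy']
  have hM₀le : M₀ ≤ conwayNortonLatticeAtThree N := by
    refine le_conwayNortonLatticeAtThree ?_ ?_ ?_ ?_
    · -- `M₀ ≤ S ⊗ ℤ[ζ₃]`
      rw [hM₀, Submodule.span_le]
      intro x hx
      simp only [Set.mem_insert_iff, Set.mem_singleton_iff] at hx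
      rcases hx with rfl | rfl | rfl | rfl
      exacts [Submodule.mem_sup_left huS, Submodule.mem_sup_left hvS, Submodule.mem_sup_right ⟨u, huS, rfl⟩,
        Submodule.mem_sup_right ⟨v, hvS, rfl⟩]
    · exact fun x ⟨y, hy, hyx⟩ => hyx ▸ hζ y hy
    · -- `w_{Q_p}`-stability
      intro p hp hpN
      obtain ⟨hwu, hwv⟩ := hw p hp hpN
      have hwu' : atkinLehnerInvolutionAt N 2 p u ∈ M₀ := hpm hu hv hwu
      have hwv' : atkinLehnerInvolutionAt N 2 p v ∈ M₀ := hpm hv hu hwv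
      rw [hM₀, Submodule.map_span_le, ← hM₀]
      intro x hx
      simp only [Set.mem_insert_iff, Set.mem_singleton_iff] at hx
      change atkinLehnerInvolutionAt N 2 p x ∈ _
      rcases hx with rfl | rfl | rfl | rfl
      · exact hwu'
      · exact hwv'
      · rw [map_smul]; exact hζ _ hwu'
      · rw [map_smul]; exact hζ _ hwv'
    · -- `t_{1/3}`-stability
      rw [hM₀, Submodule.map_span_le, ← hM₀]
      intro x hx
      simp only [Set.mem_insert_iff, Set.mem_singleton_iff] at hx
      change thirdTranslate N 2 1 x ∈ _
      rcases hx with rfl | rfl | rfl | rfl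
      · rw [htu]; exact hζu
      · rw [htv, hζ2]; exact M₀.sub_mem (M₀.neg_mem hv) hζv
      · rw [map_smul, htu]; exact hζζu
      · rw [map_smul, htv, smul_smul, h3', one_smul]; exact hv
  exact ⟨hfuv ▸ hM₀le (M₀.add_mem hu hv), hguv ▸ hM₀le (M₀.sub_mem hu hv)⟩

/-! ### The non-rational branch: `M^G ∩ (ℤf + ℤζ₃f) = 0` unless `f` has integer coefficients -/

/-- `{1, ζ₃}` is `ℝ`-linearly independent: `α + β ζ₃ = 0` with `α, β ∈ ℝ` forces `α = β = 0` (`ζ₃ ∉ ℝ`, as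
`1 + t + t² > 0` for real `t`). -/
theorem eq_zero_of_add_mul_zeta3_eq_zero {α β : ℝ} (h : (α : ℂ) + β * zeta3 = 0) : α = 0 ∧ β = 0 := by
  by_cases hβ : β = 0
  · subst hβ
    simpa using h
  · exfalso
    have hz : zeta3 = ((-α / β : ℝ) : ℂ) := by
      have hβ' : (β : ℂ) ≠ 0 := by exact_mod_cast hβ
      push_cast
      rw [eq_div_iff hβ']
      linear_combination h
    have h1 := one_add_zeta3_add_sq
    rw [hz] at h1
    have h2 : (1 : ℝ) + (-α / β) + (-α / β) ^ 2 = 0 := by exact_mod_cast h1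
    nlinarith [sq_nonneg (-α / β + 1 / 2)]

omit [NeZero N] in
/-- A rational algebraic-integer Fourier coefficient is an integer: if `aₙ(h)` is an algebraic integer and equals a
rational number, it is (the image of) an integer. -/
theorem exists_int_cuspCoeff_of_rat {k : ℤ} {h : CuspForm (Gamma0 N) k} {n : ℕ}
    (hint : IsIntegral ℤ (cuspCoeff h n)) {r : ℚ} (hr : (r : ℂ) = cuspCoeff h n) : ∃ a : ℤ, cuspCoeff h n = a := by
  rw [← hr] at hint
  have hint' : IsIntegral ℤ ((algebraMap ℚ ℂ).toIntAlgHom r) := by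
    simpa only [RingHom.toIntAlgHom_apply, eq_ratCast] using hint
  have hr' : IsIntegral ℤ r :=
    (isIntegral_algHom_iff (algebraMap ℚ ℂ).toIntAlgHom (algebraMap ℚ ℂ).injective).mp hint'
  obtain ⟨a, ha⟩ := IsIntegrallyClosed.isIntegral_iff.mp hr'
  refine ⟨a, ?_⟩
  rw [← hr, ← ha]
  simp

/-- **The non-rational branch.**  If a NONZERO element of the `ℤ[ζ₃]`-line `ℤ h + ℤ ζ₃ h` of a newform `h` lies in
`S₂(Γ₀(N);ℤ) ⊗ ℤ[ζ₃] = S + ζ₃ S`, then `h` has integer coefficients: comparing `n`-th coefficients,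
`(a + b ζ₃) aₙ(h) = p + q ζ₃` with `a, b, p, q ∈ ℤ`, `(a, b) ≠ 0` and `aₙ(h)` REAL (`IsNewform0.conj_cuspCoeff`), so
`aₙ(h) ∈ ℚ`; and `aₙ(h)` is an algebraic integer (`IsNewform0.isIntegral_coeff_holds`). -/
theorem int_cuspCoeff_of_mem_span_pair_of_mem_eisensteinSpan {h : CuspForm (Gamma0 N) 2} (hh : IsNewform0 h)
    {x : CuspForm (Gamma0 N) 2} (hxP : x ∈ (ℤ ∙ h) ⊔ (ℤ ∙ (zeta3 • h)))
    (hxE : x ∈ eisensteinSpan (integralCuspForms0 N 2)) (hx0 : x ≠ 0) (n : ℕ) : ∃ a : ℤ, cuspCoeff h n = a := by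
  obtain ⟨y, hy, z, hz, hyz⟩ := Submodule.mem_sup.mp hxP
  obtain ⟨a, rfl⟩ := Submodule.mem_span_singleton.mp hy
  obtain ⟨b, rfl⟩ := Submodule.mem_span_singleton.mp hz
  obtain ⟨s₁, hs₁, w, hw, hsw⟩ := Submodule.mem_sup.mp hxE
  obtain ⟨s₂, hs₂, rfl⟩ := Submodule.mem_map.mp hw
  obtain ⟨p, hp⟩ := hs₁ n
  obtain ⟨q, hq⟩ := hs₂ n
  -- the coefficient identity `(a + b ζ₃) c = p + ζ₃ q`, `c = aₙ(h)` real
  have hc : cuspCoeff h n = ((cuspCoeff h n).re : ℂ) := hh.cuspCoeff_eq_ofReal_re n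
  set c := (cuspCoeff h n).re with hcdef
  have hab : (a : ℤ) ≠ 0 ∨ (b : ℤ) ≠ 0 := by
    by_contra hcon
    simp only [not_or, not_ne_iff] at hcon
    obtain ⟨rfl, rfl⟩ := hcon
    exact hx0 (by rw [← hyz, zero_smul, zero_smul, add_zero])
  have hcoef : ((a : ℝ) * c - p : ℝ) + ((b : ℝ) * c - q : ℝ) * zeta3 = 0 := by
    have h1 := congrArg (fun t : CuspForm (Gamma0 N) 2 => cuspCoeff t n) (hyz.trans hsw.symm)
    rw [cuspCoeff_add_gamma0, cuspCoeff_add_gamma0, ← Int.cast_smul_eq_zsmul ℂ a, ← Int.cast_smul_eq_zsmul ℂ b,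
      cuspCoeff_smul_gamma0, cuspCoeff_smul_gamma0, cuspCoeff_smul_gamma0] at h1
    change _ = cuspCoeff s₁ n + cuspCoeff (zeta3 • s₂) n at h1
    rw [cuspCoeff_smul_gamma0, ← hp, ← hq, hc] at h1
    push_cast
    linear_combination h1
  obtain ⟨h1, h2⟩ := eq_zero_of_add_mul_zeta3_eq_zero hcoef
  have hint : IsIntegral ℤ (cuspCoeff h n) := IsNewform0.isIntegral_coeff_holds hh n
  rcases hab with ha | hb
  · refine exists_int_cuspCoeff_of_rat hint (r := (p : ℚ) / a) ?_
    rw [hc]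
    have ha' : (a : ℂ) ≠ 0 := by exact_mod_cast ha
    have : (a : ℝ) * c = p := by linarith
    have this' : ((a : ℝ) : ℂ) * (c : ℂ) = ((p : ℝ) : ℂ) := by exact_mod_cast this
    push_cast at this' ⊢
    rw [div_eq_iff ha']
    linear_combination -this'
  · refine exists_int_cuspCoeff_of_rat hint (r := (q : ℚ) / b) ?_
    rw [hc]
    have hb' : (b : ℂ) ≠ 0 := by exact_mod_cast hb
    have : (b : ℝ) * c = q := by linarith
    have this' : ((b : ℝ) : ℂ) * (c : ℂ) = ((q : ℝ) : ℂ) := by exact_mod_cast this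
    push_cast at this' ⊢
    rw [div_eq_iff hb']
    linear_combination -this'

/-- Hence: if the newform `h` does NOT have integer coefficients, `M^G(N) ∩ (ℤ h + ℤ ζ₃ h) = 0`. -/
theorem conwayNortonLatticeAtThree_inf_span_pair_eq_bot {h : CuspForm (Gamma0 N) 2} (hh : IsNewform0 h)
    (hnot : ¬ ∀ n : ℕ, ∃ a : ℤ, cuspCoeff h n = a) :
    conwayNortonLatticeAtThree N ⊓ ((ℤ ∙ h) ⊔ (ℤ ∙ (zeta3 • h))) = ⊥ := by
  rw [eq_bot_iff]
  intro x hx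
  obtain ⟨hxM, hxP⟩ := Submodule.mem_inf.mp hx
  rw [Submodule.mem_bot]
  by_contra hx0
  exact hnot (int_cuspCoeff_of_mem_span_pair_of_mem_eisensteinSpan hh hxP (conwayNortonLatticeAtThree_le hxM) hx0)

/-- `f` has integer coefficients as soon as `f ⊗ χ₋₃` does (`f` a newform at `9 ∣ N`: `aₙ(f) = χ(n) aₙ(f ⊗ χ)` off
`3 ∣ n`, and `aₙ(f) = 0` for `3 ∣ n`). -/
theorem int_cuspCoeff_of_int_cuspCoeff_charTwist (h9 : 3 ^ 2 ∣ N) {χ : DirichletCharacter ℂ 3} (hχ : χ.IsQuadratic)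
    (hprim : χ.IsPrimitive) {f : CuspForm (Gamma0 N) 2} (hf : IsNewform0 f)
    (hint : ∀ n : ℕ, ∃ a : ℤ, cuspCoeff (charTwist N dvd_rfl h9 hχ f) n = a) (n : ℕ) : ∃ a : ℤ, cuspCoeff f n = a := by
  obtain ⟨a, ha⟩ := hint n
  rw [cuspCoeff_charTwist (L := N) (hN := dvd_rfl) (hm := h9) (hχ := hχ) (hprim := hprim) (f := f) (n := n)] at ha
  rcases cuspCoeff_trichotomy_mod_three h9 hχ hprim hf n with h0 | ⟨h1, -⟩ | ⟨h2, -⟩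
  · exact ⟨0, by rw [h0, Int.cast_zero]⟩
  · exact ⟨a, by rw [← ha, h1, one_mul]⟩
  · exact ⟨-a, by rw [Int.cast_neg, ← ha, h2]; ring⟩

end Summit.BirchSwinnertonDyer.BirchSwinnertonDyer.Theorems.ManinLocalTwoThree

end
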